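import Literature.NumberTheory.Automorphic.UnitaryGroupHeisenbergKAverageArchSmooth
import Literature.NumberTheory.Automorphic.UnitaryGroupTraceZeroLine
import Literature.NumberTheory.Automorphic.UnitaryGroupGlobalGenericity
import Literature.NumberTheory.Automorphic.AdelicSecondCountable
import HarnessLib

/-!
# The line function of `U(J₂)` is smooth in the archimedean variable: `t_∞ ↦ ∫_K f(k⁻¹ (z n(θ(t_∞, y))) k) dμK` is `C^∞`
(Rogawski, *Automorphic Representations of Unitary Groups in Three Variables* (1990), §7.3, Prop. 7.3.1 (pp. 97–98): for `U(2)` the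
unipotent term is «as in the previous section» the Tate integral over `F^* N𝕀_E ∖ 𝕀_F` of the function `ψ^K` on the unipotent LINE;
Hörmander, Thm. 1.1.9)

Topic `NumberTheory/Automorphic`; namespace `Literature.NumberTheory.Automorphic.UnitaryGroup`. THEOREMS ONLY over accepted tree modules
(no definition, no named fact, no instance, no notation, no `sorry`). FILE 1 of the H-side row (σ-u) «`LineKAverageSchwartzBruhatTwo`» of
`CENSUS-LAWS-Hside` (cell `pub/hodgecm-mathlib`, crux H413, `Cruxes/H413/Lines/F0_T1InnerFormTraceIdentity.lean`): the `N = 2` twin of ★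
`UnitaryGroupHeisenbergKAverageArchSmooth` ∕ ★ `UnitaryGroupSingularLineArchSmooth` — for the rank-one quasi-split `U(J₂)` the unipotent
radical IS the trace-zero line (`N(𝔸_F) ≅ 𝔸_E⁻`, abelian, no Heisenberg `x`-variable). FILE 2 (`UnitaryGroupLineKAverageSchwartzBruhatTwo`)
concludes `ψ^K ∘ θ ∈ 𝒮(𝔸_F)`.

Letters: `G = U(J₂)` (`quasiSplit F E c 2`), `π = adelicVal`, the LINE CHART `n(b) = 1 + b E₀₁ = middleRootUnipotent hij hN (ofAdd b)`
(★ `UnitaryGroupGlobalGenericity`, `(N, i, j) = (2, 0, 1)`, `hij`, `hN` the two `rfl` side conditions — definition-free, as the H-side census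
rules; cf. H-B1 `UnitaryGroupLineUnipotentTwo`), the centre line `θ = traceZeroLine F E c hcδ hδ : 𝔸_F ≃ₜ+ 𝔸_E⁻` (★ `UnitaryGroupTraceZeroLine`),
ANY `z ∈ G(𝔸_F)` (central in Prop. 7.3.1), a compact subgroup `K ≤ G(𝔸_F)` with a finite Borel measure `μK`, and a test function `f`
(★ `IsQuasiSplitTest F E c 2 f`).

* §1 `coe_adelicVal_middleRootUnipotent_two`, `coe_toMixed_adelicVal_middleRootUnipotent_two` (`π(n b) = 1 + bE₀₁`, `π(n b)_∞ = 1 + b_∞E₀₁`),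
  `continuous_coe_middleRootUnipotent_two`, the TUBE LEMMA ALONG THE LINE `exists_levelIdeal_forall_conj_line_traceZeroLine_mem_two`, and
  the uniform compact support `exists_isCompact_lineKernel_conj_support_two` (`b` is read back as the `(0,1)` entry).
* §2 **`contDiff_lineKAverage_two`** (and `…_of_isSmoothKernelGL`) — for every `y ∈ 𝔸_F^∞`, `t_∞ ↦ ∫_K f(k⁻¹ (z n(θ(t_∞, y))) k) dμK` is
  `C^∞` on `F_∞`: ★ `IsSmoothKernelGL.contDiff_integral_of_toMixed_eq` (Hörmander 1.1.9) on `A := K`, archimedean part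
  `π(k⁻¹)_∞ (π(z)_∞ (1 + (θ t)_∞E₀₁)) π(k)_∞`, real-affine in `t_∞`.

## References

* J. D. Rogawski, *Automorphic Representations of Unitary Groups in Three Variables*, Ann. of Math. Stud. 123 (1990), §7.3
  Prop. 7.3.1 (pp. 97–98), §1.10 [Rogawski1990].
* A. Weil, *Basic Number Theory*, Grundlehren 144 (1967), Ch. VII §2 [WeilBNT1967].
* L. Hörmander, *The Analysis of Linear Partial Differential Operators I*, Grundlehren 256 (1983), Thm. 1.1.9 [HormanderALPDO1].
-/

set_option autoImplicit false

noncomputable section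

open MeasureTheory NumberField NumberField.mixedEmbedding IsDedekindDomain Set Topology Filter Function
-- `Classical` is needed to see the Mathlib normed-space instances on `mixedSpace E` (note H5 of `AdelicGLnGlue`)
open scoped ContDiff Classical MatrixGroups Matrix

namespace Literature.NumberTheory.Automorphic

namespace UnitaryGroup

-- the Banach algebra structure of `M_n(K_∞)` through which `IsArchSmooth` is defined
open scoped Matrix.Norms.Operator

variable {F E : Type} [Field F] [NumberField F] [Field E] [NumberField E] [Algebra F E] {c : E ≃ₐ[F] E}
  (hij : (((0 : Fin 2) : ℕ)) + 1 = ((1 : Fin 2) : ℕ)) (hN : 2 = 2 * ((0 : Fin 2) : ℕ) + 2)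

/-! ## §1 The line chart of `U(J₂)`: matrices, archimedean part, continuity, tube lemma, supports -/

section Plumbing

/-- **`π(n b) = 1 + b E₀₁`** (★ `coe_adelicVal_middleRootAdelicHom`, ★ `middleRootMatrix`). [cite: Rogawski1990, §1.10] -/
theorem coe_adelicVal_middleRootUnipotent_two (b : traceZeroAdele F E c) :
    ((adelicVal F E c 2 _ ((middleRootUnipotent hij hN (Multiplicative.ofAdd b) : adelicUnipotent F E c 2) : (quasiSplit F E c 2).Adelic) :
        GL (Fin 2) (AdeleRing (𝓞 E) E)) : Matrix (Fin 2) (Fin 2) (AdeleRing (𝓞 E) E)) =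
      1 + Matrix.single 0 1 (b : AdeleRing (𝓞 E) E) := rfl

/-- **`π(n b)_∞ = 1 + b_∞ E₀₁`**: the archimedean part of the line chart, read in `M₂(E_∞)` through ★ `archHom`. [cite: Rogawski1990, §1.10] -/
theorem coe_toMixed_adelicVal_middleRootUnipotent_two (b : traceZeroAdele F E c) :
    ((GLn.toMixed 2 E (adelicVal F E c 2 _ ((middleRootUnipotent hij hN (Multiplicative.ofAdd b) : adelicUnipotent F E c 2) :
        (quasiSplit F E c 2).Adelic)) : GL (Fin 2) (mixedSpace E)) : Matrix (Fin 2) (Fin 2) (mixedSpace E)) =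
      1 + Matrix.single 0 1 (archHom E (b : AdeleRing (𝓞 E) E)) := by
  have h : ((GLn.toMixed 2 E (adelicVal F E c 2 _ ((middleRootUnipotent hij hN (Multiplicative.ofAdd b) : adelicUnipotent F E c 2) :
        (quasiSplit F E c 2).Adelic)) : GL (Fin 2) (mixedSpace E)) : Matrix (Fin 2) (Fin 2) (mixedSpace E)) =
      ((adelicVal F E c 2 _ ((middleRootUnipotent hij hN (Multiplicative.ofAdd b) : adelicUnipotent F E c 2) : (quasiSplit F E c 2).Adelic) :
        GL (Fin 2) (AdeleRing (𝓞 E) E)) : Matrix (Fin 2) (Fin 2) (AdeleRing (𝓞 E) E)).map (archHom E) := Matrix.ext fun _ _ => rfl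
  rw [h, coe_adelicVal_middleRootUnipotent_two, Matrix.map_add _ (map_add (archHom E)),
    Matrix.map_one (archHom E) (map_zero _) (map_one _), Matrix.map_single]

/-- The line chart `b ↦ n(b) ∈ G(𝔸_F)` is continuous (entries `1`, `0`, `b` and inverse `n(-b)`). [cite: Rogawski1990, §1.10] -/
theorem continuous_coe_middleRootUnipotent_two :
    Continuous fun b : traceZeroAdele F E c =>
      ((middleRootUnipotent hij hN (Multiplicative.ofAdd b) : adelicUnipotent F E c 2) : (quasiSplit F E c 2).Adelic) := by
  have hmat : Continuous fun x : AdeleRing (𝓞 E) E => middleRootMatrix 2 (0 : Fin 2) (1 : Fin 2) x := by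
    refine continuous_const.add (continuous_pi fun p => continuous_pi fun q => ?_)
    simp only [Matrix.single_apply]
    split_ifs
    · exact continuous_id
    · exact continuous_const
  have hval : Continuous fun b : traceZeroAdele F E c =>
      adelicVal F E c 2 _ ((middleRootUnipotent hij hN (Multiplicative.ofAdd b) : adelicUnipotent F E c 2) : (quasiSplit F E c 2).Adelic) := by
    refine Units.continuous_iff.2 ⟨?_, ?_⟩
    · exact hmat.comp continuous_subtype_val
    · refine (hmat.comp continuous_subtype_val.neg).congr fun b => ?_
      rfl
  exact continuous_induced_rng.2 hval

/-- The matrix `n(0) = 1`. [cite: Rogawski1990, §1.10] -/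
theorem coe_middleRootUnipotent_zero_two :
    ((middleRootUnipotent hij hN (Multiplicative.ofAdd (0 : traceZeroAdele F E c)) : adelicUnipotent F E c 2) : (quasiSplit F E c 2).Adelic) = 1 := by
  rw [ofAdd_zero, map_one, OneMemClass.coe_one]

/-- `n(b + b′) = n(b) n(b′)` in `G(𝔸_F)` (the line chart is a homomorphism). [cite: Rogawski1990, §1.10] -/
theorem coe_middleRootUnipotent_add_two (b b' : traceZeroAdele F E c) :
    ((middleRootUnipotent hij hN (Multiplicative.ofAdd (b + b')) : adelicUnipotent F E c 2) : (quasiSplit F E c 2).Adelic) =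
      ((middleRootUnipotent hij hN (Multiplicative.ofAdd b) : adelicUnipotent F E c 2) : (quasiSplit F E c 2).Adelic) *
        ((middleRootUnipotent hij hN (Multiplicative.ofAdd b') : adelicUnipotent F E c 2) : (quasiSplit F E c 2).Adelic) := by
  rw [ofAdd_add, map_mul, Subgroup.coe_mul]

variable [Algebra.IsQuadraticExtension F E] {δ : E}

/-- **THE TUBE LEMMA ALONG THE LINE** (`N = 2`): for an open `U ∋ 1` of `G(𝔸_F)` and a compact `K ⊆ G(𝔸_F)` there is an ideal `𝔫 ≠ 0` of `𝓞_F`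
with `k⁻¹ · n(θ(0, δ′)) · k ∈ U` for every `δ′ ∈ 𝔫𝒪̂_F`, `k ∈ K` (Mathlib `generalized_tube_lemma`; ★
`FiniteAdeleRing.exists_forall_valued_le_idealRadius_imp_mem`). [cite: WeilBNT1967, Ch. VII §2] [cite: Rogawski1990, §7.3 (pp. 97–98)] -/
theorem exists_levelIdeal_forall_conj_line_traceZeroLine_mem_two (hcδ : c δ = -δ) (hδ : δ ≠ 0)
    {K : Set (quasiSplit F E c 2).Adelic} (hK : IsCompact K) {U : Set (quasiSplit F E c 2).Adelic} (hUo : IsOpen U)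
    (hU1 : (1 : (quasiSplit F E c 2).Adelic) ∈ U) :
    ∃ 𝔫 : Ideal (𝓞 F), 𝔫 ≠ 0 ∧ ∀ δ' ∈ levelIdeal F 𝔫, ∀ k ∈ K,
      k⁻¹ * ((middleRootUnipotent hij hN (Multiplicative.ofAdd
        (traceZeroLine F E c hcδ hδ ((((0 : InfiniteAdeleRing F), δ') : AdeleRing (𝓞 F) F)))) : adelicUnipotent F E c 2) :
          (quasiSplit F E c 2).Adelic) * k ∈ U := by
  set Θ : (quasiSplit F E c 2).Adelic × FiniteAdeleRing (𝓞 F) F → (quasiSplit F E c 2).Adelic := fun p =>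
    p.1⁻¹ * ((middleRootUnipotent hij hN (Multiplicative.ofAdd
      (traceZeroLine F E c hcδ hδ ((((0 : InfiniteAdeleRing F), p.2) : AdeleRing (𝓞 F) F)))) : adelicUnipotent F E c 2) :
        (quasiSplit F E c 2).Adelic) * p.1 with hΘ
  have hδc : Continuous fun δ' : FiniteAdeleRing (𝓞 F) F => ((((0 : InfiniteAdeleRing F), δ') : AdeleRing (𝓞 F) F)) :=
    continuous_const.prodMk continuous_id
  have hΘc : Continuous Θ := by
    refine (continuous_fst.inv.mul ?_).mul continuous_fst
    exact (continuous_coe_middleRootUnipotent_two hij hN).comp ((traceZeroLine F E c hcδ hδ).continuous.comp (hδc.comp continuous_snd))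
  have hsub : K ×ˢ ({0} : Set (FiniteAdeleRing (𝓞 F) F)) ⊆ Θ ⁻¹' U := by
    rintro ⟨k, δ'⟩ ⟨-, hδ0⟩
    rw [mem_singleton_iff] at hδ0
    subst hδ0
    have hθ0 : traceZeroLine F E c hcδ hδ ((((0 : InfiniteAdeleRing F), (0 : FiniteAdeleRing (𝓞 F) F)) : AdeleRing (𝓞 F) F)) = 0 :=
      map_zero _
    have h1 : Θ (k, 0) = 1 := by
      show k⁻¹ * ((middleRootUnipotent hij hN (Multiplicative.ofAdd
        (traceZeroLine F E c hcδ hδ ((((0 : InfiniteAdeleRing F), (0 : FiniteAdeleRing (𝓞 F) F)) : AdeleRing (𝓞 F) F)))) :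
          adelicUnipotent F E c 2) : (quasiSplit F E c 2).Adelic) * k = 1
      rw [hθ0, coe_middleRootUnipotent_zero_two hij hN, mul_one, inv_mul_cancel]
    show Θ (k, 0) ∈ U
    rw [h1]
    exact hU1
  obtain ⟨u', v, -, hvo, hKu', h0v, huv⟩ := generalized_tube_lemma hK isCompact_singleton (hUo.preimage hΘc) hsub
  have hv : v ∈ 𝓝 (0 : FiniteAdeleRing (𝓞 F) F) := hvo.mem_nhds (h0v (mem_singleton 0))
  obtain ⟨𝔫, h𝔫, h𝔫v⟩ := FiniteAdeleRing.exists_forall_valued_le_idealRadius_imp_mem (K := F) hv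
  refine ⟨𝔫, h𝔫, fun δ' hδL k hk => ?_⟩
  have hmem : (k, δ') ∈ Θ ⁻¹' U := huv ⟨hKu' hk, h𝔫v δ' fun v => hδL v⟩
  exact hmem

omit [Algebra.IsQuadraticExtension F E] in
/-- **UNIFORM COMPACT SUPPORT along the line with a compact conjugating variable.** For `f` of compact support, `K` compact and any
`z ∈ G(𝔸_F)` there is a compact `W_c ⊆ 𝔸_E⁻` with `f(k⁻¹ (z n(b)) k) ≠ 0 ⇒ b ∈ W_c` for all `k ∈ K` (`n(b) ∈ z⁻¹ K (tsupport f) K⁻¹`, and `b`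
is the `(0,1)` entry of `π(n b)`, ★ `unipotentEntry_middleRootUnipotent_self`; `𝔸_E⁻` is closed, ★ `isClosed_traceZeroAdele`).
[cite: Rogawski1990, §7.3 (pp. 97–98)] -/
theorem exists_isCompact_lineKernel_conj_support_two {KU : Set (quasiSplit F E c 2).Adelic} (hK : IsCompact KU)
    (z : (quasiSplit F E c 2).Adelic) {f : (quasiSplit F E c 2).Adelic → ℂ} (hf : HasCompactSupport f) :
    ∃ W_c : Set (traceZeroAdele F E c), IsCompact W_c ∧ ∀ k ∈ KU, ∀ b : traceZeroAdele F E c,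
      f (k⁻¹ * (z * ((middleRootUnipotent hij hN (Multiplicative.ofAdd b) : adelicUnipotent F E c 2) : (quasiSplit F E c 2).Adelic)) * k) ≠ 0 →
        b ∈ W_c := by
  -- the compact `S₁ = z⁻¹ K (tsupport f) K⁻¹ ⊆ G(𝔸_F)`
  set S₁ : Set (quasiSplit F E c 2).Adelic :=
    (fun p : (quasiSplit F E c 2).Adelic × (quasiSplit F E c 2).Adelic => z⁻¹ * (p.1 * p.2 * p.1⁻¹)) '' (KU ×ˢ tsupport f) with hS₁
  have hS₁c : IsCompact S₁ :=
    (hK.prod hf.isCompact).image (continuous_const.mul ((continuous_fst.mul continuous_snd).mul continuous_fst.inv))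
  -- the `(0,1)` entry, continuous on `G(𝔸_F)`
  set e01 : (quasiSplit F E c 2).Adelic → AdeleRing (𝓞 E) E := fun g =>
    ((adelicVal F E c 2 _ g : GL (Fin 2) (AdeleRing (𝓞 E) E)) : Matrix (Fin 2) (Fin 2) (AdeleRing (𝓞 E) E)) 0 1 with he01
  have he01c : Continuous e01 := by
    have hval : Continuous fun g : (quasiSplit F E c 2).Adelic =>
        ((adelicVal F E c 2 _ g : GL (Fin 2) (AdeleRing (𝓞 E) E)) : Matrix (Fin 2) (Fin 2) (AdeleRing (𝓞 E) E)) :=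
      Units.continuous_val.comp continuous_subtype_val
    exact hval.matrix_elem 0 1
  have hcl := isClosed_traceZeroAdele (F := F) (E := E) (c := c)
  refine ⟨Subtype.val ⁻¹' (e01 '' S₁), hcl.isClosedEmbedding_subtypeVal.isCompact_preimage (hS₁c.image he01c), fun k hk b hne => ?_⟩
  have hmem : ((middleRootUnipotent hij hN (Multiplicative.ofAdd b) : adelicUnipotent F E c 2) : (quasiSplit F E c 2).Adelic) ∈ S₁ := by
    refine ⟨(k, k⁻¹ * (z * ((middleRootUnipotent hij hN (Multiplicative.ofAdd b) : adelicUnipotent F E c 2) : (quasiSplit F E c 2).Adelic)) * k),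
      ⟨hk, subset_tsupport _ hne⟩, ?_⟩
    dsimp only
    group
  refine ⟨_, hmem, ?_⟩
  show ((adelicVal F E c 2 _ ((middleRootUnipotent hij hN (Multiplicative.ofAdd b) : adelicUnipotent F E c 2) : (quasiSplit F E c 2).Adelic) :
      GL (Fin 2) (AdeleRing (𝓞 E) E)) : Matrix (Fin 2) (Fin 2) (AdeleRing (𝓞 E) E)) 0 1 = (b : AdeleRing (𝓞 E) E)
  rw [coe_adelicVal_middleRootUnipotent_two, Matrix.add_apply, Matrix.one_apply_ne (by decide), Matrix.single_apply_same, zero_add]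

end Plumbing

/-! ## §2 Archimedean smoothness of the line function -/

section ArchSmooth

variable [Algebra.IsQuadraticExtension F E] {δ : E}
  {KU : Subgroup (quasiSplit F E c 2).Adelic} [MeasurableSpace KU] [BorelSpace KU]

/-- **ARCHIMEDEAN SMOOTHNESS OF THE LINE FUNCTION (smooth-kernel form).** Let `f = η ∘ π` for a smooth kernel `η` on `GL₂(𝔸_E)`,
`K ≤ G(𝔸_F)` compact with a finite Borel measure `μK`, `z ∈ G(𝔸_F)`, `θ` the centre line. Then for every `y ∈ 𝔸_F^∞`,
`t_∞ ↦ ∫_K f(k⁻¹ (z n(θ(t_∞, y))) k) dμK` is `C^∞` on `F_∞` (★ `IsSmoothKernelGL.contDiff_integral_of_toMixed_eq` on `A := K`; the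
archimedean part of the argument is `π(k⁻¹)_∞ (π(z)_∞ (1 + (θ t)_∞ E₀₁)) π(k)_∞`, real-affine in `t_∞`).
[cite: Rogawski1990, §7.3 (pp. 97–98)] [cite: HormanderALPDO1, Thm. 1.1.9] -/
theorem contDiff_lineKAverage_two_of_isSmoothKernelGL (hcδ : c δ = -δ) (hδ : δ ≠ 0)
    (hK : IsCompact (KU : Set (quasiSplit F E c 2).Adelic)) (μK : Measure KU) [IsFiniteMeasure μK] (z : (quasiSplit F E c 2).Adelic)
    {f : (quasiSplit F E c 2).Adelic → ℂ} {η : GL (Fin 2) (AdeleRing (𝓞 E) E) → ℂ} (hη : IsSmoothKernelGL 2 E η)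
    (hfη : ∀ g, f g = η (adelicVal F E c 2 _ g)) (y : FiniteAdeleRing (𝓞 F) F) :
    ContDiff ℝ ∞ fun s : mixedSpace F =>
      ∫ k, f ((k : (quasiSplit F E c 2).Adelic)⁻¹ * (z * ((middleRootUnipotent hij hN (Multiplicative.ofAdd
        (traceZeroLine F E c hcδ hδ ((((InfiniteAdeleRing.ringEquiv_mixedSpace F).symm s, y) : AdeleRing (𝓞 F) F)))) :
          adelicUnipotent F E c 2) : (quasiSplit F E c 2).Adelic)) * k) ∂μK := by
  haveI : T2Space (AdeleRing (𝓞 E) E) := t2Space_adeleRing E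
  haveI : SecondCountableTopology (AdeleRing (𝓞 E) E) := secondCountableTopology_adeleRing E
  haveI : SecondCountableTopology (GL (Fin 2) (AdeleRing (𝓞 E) E)) := secondCountableTopology_generalLinearGroup_adeleRing E (Fin 2)
  haveI : SecondCountableTopology (quasiSplit F E c 2).Adelic :=
    inferInstanceAs (SecondCountableTopology (adelic F E c 2 ((StdForm.antidiagonal 2).over E)))
  haveI : SecondCountableTopology KU := TopologicalSpace.Subtype.secondCountableTopology _
  haveI : CompactSpace KU := isCompact_iff_compactSpace.1 hK
  -- abbreviations
  set nA : traceZeroAdele F E c → (quasiSplit F E c 2).Adelic := fun b =>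
    ((middleRootUnipotent hij hN (Multiplicative.ofAdd b) : adelicUnipotent F E c 2) : (quasiSplit F E c 2).Adelic) with hnA
  have hnAc : Continuous nA := continuous_coe_middleRootUnipotent_two hij hN
  -- the family `G k s = π(k⁻¹ (z n(θ(s, y))) k)`
  set G : KU → mixedSpace F → GL (Fin 2) (AdeleRing (𝓞 E) E) := fun k s =>
    adelicVal F E c 2 _ (((k : (quasiSplit F E c 2).Adelic))⁻¹ * (z *
      nA (traceZeroLine F E c hcδ hδ ((((InfiniteAdeleRing.ringEquiv_mixedSpace F).symm s, y) : AdeleRing (𝓞 F) F)))) *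
      (k : (quasiSplit F E c 2).Adelic)) with hGdef
  have hsθ : Continuous fun s : mixedSpace F =>
      traceZeroLine F E c hcδ hδ ((((InfiniteAdeleRing.ringEquiv_mixedSpace F).symm s, y) : AdeleRing (𝓞 F) F)) :=
    (traceZeroLine F E c hcδ hδ).continuous.comp ((continuous_ringEquiv_mixedSpace_symm F).prodMk continuous_const)
  have hk : Continuous fun q : KU × mixedSpace F => (q.1 : (quasiSplit F E c 2).Adelic) := continuous_subtype_val.comp continuous_fst
  have hnθ : Continuous fun q : KU × mixedSpace F =>
      nA (traceZeroLine F E c hcδ hδ ((((InfiniteAdeleRing.ringEquiv_mixedSpace F).symm q.2, y) : AdeleRing (𝓞 F) F))) :=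
    hnAc.comp (hsθ.comp continuous_snd)
  have hGc : Continuous (Function.uncurry G) :=
    continuous_subtype_val.comp ((hk.inv.mul (continuous_const.mul hnθ)).mul hk)
  -- the archimedean reading of the centre line is real-affine in `t_∞`
  set Ladd : mixedSpace F →+ mixedSpace E :=
    (archHom E).toAddMonoidHom.comp ((traceZeroAdele F E c).subtype.comp
      (((traceZeroLine F E c hcδ hδ : AdeleRing (𝓞 F) F →+ traceZeroAdele F E c)).comp
        ((AddMonoidHom.inl (InfiniteAdeleRing F) (FiniteAdeleRing (𝓞 F) F)).comp
          ((InfiniteAdeleRing.ringEquiv_mixedSpace F).symm : mixedSpace F →+ InfiniteAdeleRing F)))) with hLadd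
  have hLapply : ∀ s : mixedSpace F, Ladd s = archHom E (((traceZeroLine F E c hcδ hδ)
      ((((InfiniteAdeleRing.ringEquiv_mixedSpace F).symm s, (0 : FiniteAdeleRing (𝓞 F) F)) : AdeleRing (𝓞 F) F)) :
        traceZeroAdele F E c) : AdeleRing (𝓞 E) E) := fun s => rfl
  have hLc : Continuous Ladd := by
    have h : Continuous fun s : mixedSpace F => archHom E (((traceZeroLine F E c hcδ hδ)
        ((((InfiniteAdeleRing.ringEquiv_mixedSpace F).symm s, (0 : FiniteAdeleRing (𝓞 F) F)) : AdeleRing (𝓞 F) F)) :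
          traceZeroAdele F E c) : AdeleRing (𝓞 E) E) :=
      ((continuous_ringEquiv_mixedSpace E).comp continuous_fst).comp (continuous_subtype_val.comp
        ((traceZeroLine F E c hcδ hδ).continuous.comp ((continuous_ringEquiv_mixedSpace_symm F).prodMk continuous_const)))
    exact h.congr fun s => (hLapply s).symm
  set L : mixedSpace F →L[ℝ] mixedSpace E := Ladd.toRealLinearMap hLc with hLdef
  set wy : mixedSpace E := archHom E (((traceZeroLine F E c hcδ hδ) ((((0 : InfiniteAdeleRing F), y) : AdeleRing (𝓞 F) F)) :
    traceZeroAdele F E c) : AdeleRing (𝓞 E) E) with hwy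
  have hθs : ∀ s : mixedSpace F, archHom E (((traceZeroLine F E c hcδ hδ)
      ((((InfiniteAdeleRing.ringEquiv_mixedSpace F).symm s, y) : AdeleRing (𝓞 F) F)) : traceZeroAdele F E c) : AdeleRing (𝓞 E) E) =
        L s + wy := by
    intro s
    set a₁ : AdeleRing (𝓞 F) F := ((((InfiniteAdeleRing.ringEquiv_mixedSpace F).symm s, (0 : FiniteAdeleRing (𝓞 F) F)) :
      AdeleRing (𝓞 F) F)) with ha₁
    set a₂ : AdeleRing (𝓞 F) F := ((((0 : InfiniteAdeleRing F), y) : AdeleRing (𝓞 F) F)) with ha₂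
    have hsplit : ((((InfiniteAdeleRing.ringEquiv_mixedSpace F).symm s, y) : AdeleRing (𝓞 F) F)) = a₁ + a₂ :=
      Prod.ext (add_zero _).symm (zero_add _).symm
    rw [hsplit, map_add, AddSubgroup.coe_add, map_add]
    rfl
  -- the polynomial `M` and the parameters `α`
  set M : (Matrix (Fin 2) (Fin 2) (mixedSpace E) × (Matrix (Fin 2) (Fin 2) (mixedSpace E) × Matrix (Fin 2) (Fin 2) (mixedSpace E))) ×
      mixedSpace F → Matrix (Fin 2) (Fin 2) (mixedSpace E) := fun q =>
    q.1.1 * (q.1.2.1 * (1 + Matrix.single 0 1 (L q.2 + wy))) * q.1.2.2 with hMdef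
  have hsingle : ContDiff ℝ ∞ fun v : mixedSpace E => Matrix.single (0 : Fin 2) (1 : Fin 2) v := by
    set ℓ : mixedSpace E →ₗ[ℝ] Matrix (Fin 2) (Fin 2) (mixedSpace E) :=
      { toFun := fun v => Matrix.single 0 1 v
        map_add' := Matrix.single_add 0 1
        map_smul' := fun r v => (Matrix.smul_single r 0 1 v).symm } with hℓ
    exact ℓ.toContinuousLinearMap.contDiff
  have hMs : ContDiff ℝ ∞ M := by
    have hA : ContDiff ℝ ∞ fun q : (Matrix (Fin 2) (Fin 2) (mixedSpace E) × (Matrix (Fin 2) (Fin 2) (mixedSpace E) ×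
        Matrix (Fin 2) (Fin 2) (mixedSpace E))) × mixedSpace F => q.1.1 := contDiff_fst.comp contDiff_fst
    have hB : ContDiff ℝ ∞ fun q : (Matrix (Fin 2) (Fin 2) (mixedSpace E) × (Matrix (Fin 2) (Fin 2) (mixedSpace E) ×
        Matrix (Fin 2) (Fin 2) (mixedSpace E))) × mixedSpace F => q.1.2.1 := contDiff_fst.comp (contDiff_snd.comp contDiff_fst)
    have hD : ContDiff ℝ ∞ fun q : (Matrix (Fin 2) (Fin 2) (mixedSpace E) × (Matrix (Fin 2) (Fin 2) (mixedSpace E) ×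
        Matrix (Fin 2) (Fin 2) (mixedSpace E))) × mixedSpace F => q.1.2.2 := contDiff_snd.comp (contDiff_snd.comp contDiff_fst)
    have hN' : ContDiff ℝ ∞ fun q : (Matrix (Fin 2) (Fin 2) (mixedSpace E) × (Matrix (Fin 2) (Fin 2) (mixedSpace E) ×
        Matrix (Fin 2) (Fin 2) (mixedSpace E))) × mixedSpace F => (1 : Matrix (Fin 2) (Fin 2) (mixedSpace E)) + Matrix.single 0 1 (L q.2 + wy) :=
      contDiff_const.add (hsingle.comp ((L.contDiff.comp contDiff_snd).add contDiff_const))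
    exact (hA.mul (hB.mul hN')).mul hD
  set α : KU → Matrix (Fin 2) (Fin 2) (mixedSpace E) × (Matrix (Fin 2) (Fin 2) (mixedSpace E) × Matrix (Fin 2) (Fin 2) (mixedSpace E)) :=
    fun k =>
      (((GLn.toMixed 2 E (adelicVal F E c 2 _ ((k : (quasiSplit F E c 2).Adelic))⁻¹) : GL (Fin 2) (mixedSpace E)) :
          Matrix (Fin 2) (Fin 2) (mixedSpace E)),
        ((((GLn.toMixed 2 E (adelicVal F E c 2 _ z)) : GL (Fin 2) (mixedSpace E)) : Matrix (Fin 2) (Fin 2) (mixedSpace E)),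
          (((GLn.toMixed 2 E (adelicVal F E c 2 _ (k : (quasiSplit F E c 2).Adelic))) : GL (Fin 2) (mixedSpace E)) :
            Matrix (Fin 2) (Fin 2) (mixedSpace E)))) with hαdef
  have hαc : Continuous α := by
    have hT : Continuous fun g : (quasiSplit F E c 2).Adelic =>
        (((GLn.toMixed 2 E (adelicVal F E c 2 _ g)) : GL (Fin 2) (mixedSpace E)) : Matrix (Fin 2) (Fin 2) (mixedSpace E)) :=
      Units.continuous_val.comp ((GLn.continuous_toMixed 2 E).comp continuous_subtype_val)
    exact (hT.comp continuous_subtype_val.inv).prodMk (continuous_const.prodMk (hT.comp continuous_subtype_val))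
  have hn : ∀ b : traceZeroAdele F E c, ((GLn.toMixed 2 E (adelicVal F E c 2 _ (nA b)) : GL (Fin 2) (mixedSpace E)) :
      Matrix (Fin 2) (Fin 2) (mixedSpace E)) = 1 + Matrix.single 0 1 (archHom E (b : AdeleRing (𝓞 E) E)) := fun b =>
    coe_toMixed_adelicVal_middleRootUnipotent_two hij hN b
  have hGM : ∀ k s, ((GLn.toMixed 2 E (G k s) : GL (Fin 2) (mixedSpace E)) : Matrix (Fin 2) (Fin 2) (mixedSpace E)) = M (α k, s) := by
    intro k s
    simp only [hGdef, hMdef, hαdef, map_mul, Units.val_mul, hn, hθs]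
  -- the uniform compact support in `t`
  have hfc : HasCompactSupport f := by
    have h : f = η ∘ adelicVal F E c 2 _ := funext hfη
    rw [h]
    have hcl : IsClosed ((adelic F E c 2 ((StdForm.antidiagonal 2).over E) : Subgroup (GL (Fin 2) (AdeleRing (𝓞 E) E))) :
        Set (GL (Fin 2) (AdeleRing (𝓞 E) E))) := isClosed_unitaryGroupOfForm_conjAdele F E c _
    exact hη.hasCompactSupport.comp_isClosedEmbedding hcl.isClosedEmbedding_subtypeVal
  obtain ⟨W_c, hW_c, hW⟩ := exists_isCompact_lineKernel_conj_support_two hij hN hK z hfc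
  set P_c : Set (mixedSpace F) := (fun t : AdeleRing (𝓞 F) F => archHom F t) '' ((traceZeroLine F E c hcδ hδ).symm '' W_c) with hP_c
  have hP_cc : IsCompact P_c :=
    (hW_c.image (traceZeroLine F E c hcδ hδ).symm.continuous).image ((continuous_ringEquiv_mixedSpace F).comp continuous_fst)
  have hsupp : ∀ (k : KU) (s : mixedSpace F), η (G k s) ≠ 0 → k ∈ (univ : Set KU) ∧ s ∈ P_c := by
    intro k s hne
    have hne' : f ((k : (quasiSplit F E c 2).Adelic)⁻¹ * (z *
        nA (traceZeroLine F E c hcδ hδ ((((InfiniteAdeleRing.ringEquiv_mixedSpace F).symm s, y) : AdeleRing (𝓞 F) F)))) *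
        (k : (quasiSplit F E c 2).Adelic)) ≠ 0 := by
      rw [hfη]
      exact hne
    have hw := hW k k.2 _ hne'
    refine ⟨mem_univ _, ⟨((((InfiniteAdeleRing.ringEquiv_mixedSpace F).symm s, y) : AdeleRing (𝓞 F) F)),
      ⟨_, hw, (traceZeroLine F E c hcδ hδ).symm_apply_apply _⟩, ?_⟩⟩
    show archHom F ((((InfiniteAdeleRing.ringEquiv_mixedSpace F).symm s, y) : AdeleRing (𝓞 F) F)) = s
    rw [archHom_apply]
    exact (InfiniteAdeleRing.ringEquiv_mixedSpace F).apply_symm_apply s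
  have hμA : μK (univ : Set KU) < ⊤ := measure_lt_top μK _
  have heq : (fun s : mixedSpace F => ∫ k, f ((k : (quasiSplit F E c 2).Adelic)⁻¹ * (z *
      nA (traceZeroLine F E c hcδ hδ ((((InfiniteAdeleRing.ringEquiv_mixedSpace F).symm s, y) : AdeleRing (𝓞 F) F)))) *
        (k : (quasiSplit F E c 2).Adelic)) ∂μK) = fun s => ∫ k, η (G k s) ∂μK := by
    funext s
    simp only [hGdef, hfη]
  show ContDiff ℝ ∞ fun s : mixedSpace F => ∫ k, f ((k : (quasiSplit F E c 2).Adelic)⁻¹ * (z *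
      nA (traceZeroLine F E c hcδ hδ ((((InfiniteAdeleRing.ringEquiv_mixedSpace F).symm s, y) : AdeleRing (𝓞 F) F)))) *
        (k : (quasiSplit F E c 2).Adelic)) ∂μK
  rw [heq]
  exact hη.contDiff_integral_of_toMixed_eq hGc hαc hMs hGM isCompact_univ MeasurableSet.univ hμA hP_cc hsupp

/-- **ARCHIMEDEAN SMOOTHNESS OF THE LINE FUNCTION** for a test function `f ∈ C_c^∞(U(J₂)(𝔸_F))` (★ `IsQuasiSplitTest F E c 2 f`): for every
`y ∈ 𝔸_F^∞`, `t_∞ ↦ ∫_K f(k⁻¹ (z n(θ(t_∞, y))) k) dμK` is `C^∞` on `F_∞`. [cite: Rogawski1990, §7.3 (pp. 97–98)] [cite: HormanderALPDO1, Thm. 1.1.9] -/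
theorem contDiff_lineKAverage_two (hcδ : c δ = -δ) (hδ : δ ≠ 0) (hK : IsCompact (KU : Set (quasiSplit F E c 2).Adelic))
    (μK : Measure KU) [IsFiniteMeasure μK] (z : (quasiSplit F E c 2).Adelic) {f : (quasiSplit F E c 2).Adelic → ℂ}
    (hf : IsQuasiSplitTest F E c 2 f) (y : FiniteAdeleRing (𝓞 F) F) :
    ContDiff ℝ ∞ fun s : mixedSpace F =>
      ∫ k, f ((k : (quasiSplit F E c 2).Adelic)⁻¹ * (z * ((middleRootUnipotent hij hN (Multiplicative.ofAdd
        (traceZeroLine F E c hcδ hδ ((((InfiniteAdeleRing.ringEquiv_mixedSpace F).symm s, y) : AdeleRing (𝓞 F) F)))) :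
          adelicUnipotent F E c 2) : (quasiSplit F E c 2).Adelic)) * k) ∂μK := by
  obtain ⟨η₁, η₂, hη₁, hη₂, hfη⟩ := hf
  exact contDiff_lineKAverage_two_of_isSmoothKernelGL hij hN hcδ hδ hK μK z (isSmoothKernelGL_of_isTestFunctionGL_pair hη₁ hη₂) hfη y

end ArchSmooth

end UnitaryGroup

end Literature.NumberTheory.Automorphic
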